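import Literature.AlgebraicGeometry.Resolution.StrictNormalCrossingsAt
import Literature.AlgebraicGeometry.Resolution.NagataCriterion
import Literature.AlgebraicGeometry.Resolution.RegularLocusPerfectField
import HarnessLib

/-!
# The strict normal crossings condition is an open condition (ring level)

Topic: `Literature/AlgebraicGeometry/Resolution`. For the formal-to-étale bridge of de Jong
1996, 4.25/4.28 (`DeJong1996FormalNormalCrossings`): Artin approximation produces the local
strict normal crossings condition (`IsSNCIdeal`, `StrictNormalCrossingsAt.lean`) at ONE point
of an étale neighbourhood, while de Jong's Definition 2.4 asks for it at all points of an étale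
cover; the gap is the classical fact that the condition spreads from a point to a Zariski
neighbourhood. This file PROVES it for algebras of finite type over a perfect field (where
regular loci of all quotients are open, `isOpen_regularLocus_of_perfectField`):

* `IsSNCIdeal.exists_notMem_forall` — let `R` be of finite type over a perfect field `k`,
  `I ⊆ R` an ideal and `𝔭` a prime such that `I R_𝔭 ⊆ R_𝔭` has local strict normal crossings
  data. Then there is `f ∉ 𝔭` such that `I R_𝔮` has local strict normal crossings data for
  every prime `𝔮 ∌ f` containing `I`.

Proof. Write `I R_𝔭 = (a₁ ⋯ a_r) R_𝔭` with `aᵢ ∈ 𝔭 ⊆ R` whose differentials at `𝔭` are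
linearly independent (clear denominators by units). For every subset `T` of the indices let
`J_T = (aᵢ : i ∈ T)`. Shrinking around `𝔭` (inverting finitely many elements outside `𝔭`) we
achieve: (a) `R_𝔮 / J_T R_𝔮` is regular for all primes `𝔮 ⊇ J_T` of the neighbourhood (the
regular locus of `R/J_T` is open and contains `𝔭/J_T`, the quotient `R_𝔭/J_T R_𝔭` of a regular
local ring by elements with independent differentials being regular, Matsumura 14.2); (b) every
minimal prime of `J_T` meeting the neighbourhood lies inside `𝔭`; (c) `I = (a₁ ⋯ a_r)` on the
neighbourhood. Then at `𝔮 ⊇ I` with `T = {i | aᵢ ∈ 𝔮}` (non-empty): `I R_𝔮 = (∏_{i ∈ T} aᵢ)`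
(the other factors are units), `R_𝔮/J_T R_𝔮` is regular by (a), and no `a_t`, `t ∈ T`, lies in
`J_{T∖t} R_𝔮`: that ideal is prime by (a), its contraction `P` to `R` is a minimal prime of
`J_{T∖t}`, hence `P ⊆ 𝔭` by (b) and `P R_𝔭 = J_{T∖t} R_𝔭`, so `a_t ∈ P` would put `a_t` in the
ideal generated by the other `aᵢ` in `R_𝔭`, contradicting independence. By
`IsSNCIdeal.of_isRegularLocalRing_quotient` (Matsumura 14.2, minimal form) the `aᵢ`, `i ∈ T`,
extend to a regular system of parameters of `R_𝔮`.

## Sources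

* A. J. de Jong, *Smoothness, semi-stability and alterations*, Publ. Math. IHÉS 83 (1996), 2.4.
* H. Matsumura, *Commutative Ring Theory* (1986), Thm. 14.2; §30, Cor. to Thm. 30.5 (regular
  loci over perfect fields).
* The Stacks Project, Tags 0BI9, 0BIA.
-/

noncomputable section

open IsLocalRing

universe u

namespace Literature.AlgebraicGeometry.Resolution

/-! ## Quotients by elements with independent differentials -/

section Quotient

variable {B : Type u} [CommRing B] [IsRegularLocalRing B] {c : ℕ} (f : Fin c → B)
  (hf : ∀ i, f i ∈ maximalIdeal B)
  (hli : LinearIndependent (ResidueField B) fun i => (maximalIdeal B).toCotangent ⟨f i, hf i⟩)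

include hli in
/-- In a regular local ring, the quotient by a sub-family of elements with linearly independent
differentials is a regular local ring (Matsumura, Thm. 14.2; tree
`isRegularLocalRing_quotient_span`). [cite: Matsumura1987, Thm. 14.2] -/
theorem isRegularLocalRing_quotient_span_image_of_linearIndependent_toCotangent
    (T : Set (Fin c)) : IsRegularLocalRing (B ⧸ Ideal.span (f '' T)) := by
  classical
  haveI : Fintype T := Fintype.ofFinite _
  set s : Finset B := (Finset.univ : Finset T).image (fun t : T => f (t : Fin c)) with hs
  have hsT : (s : Set B) = f '' T := by
    ext y
    simp only [hs, Finset.coe_image, Finset.coe_univ, Set.image_univ, Set.mem_range,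
      Set.mem_image]
    constructor
    · rintro ⟨t, rfl⟩; exact ⟨t, t.2, rfl⟩
    · rintro ⟨j, hj, rfl⟩; exact ⟨⟨j, hj⟩, rfl⟩
  have hsm : (s : Set B) ⊆ maximalIdeal B := by
    rw [hsT]; rintro _ ⟨j, -, rfl⟩; exact hf j
  have hli' : LinearIndependent (ResidueField B)
      (fun x : s => (maximalIdeal B).toCotangent ⟨x, hsm x.2⟩) := by
    have hex : ∀ x : s, ∃ t : T, f t = x := fun x => by
      have hx := x.2
      rw [← Finset.mem_coe, hsT] at hx
      obtain ⟨j, hj, hjx⟩ := hx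
      exact ⟨⟨j, hj⟩, hjx⟩
    choose e he using hex
    have heinj : Function.Injective (fun x : s => ((e x : T) : Fin c)) := by
      intro x y hxy
      apply Subtype.ext
      rw [← he x, ← he y]
      exact congrArg f hxy
    have := hli.comp _ heinj
    convert this using 1
    funext x
    simp only [Function.comp, he x]
  rw [← hsT]
  exact isRegularLocalRing_quotient_span s hsm hli'

end Quotient

/-! ## Spreading lemmas around a prime -/

section Spread

variable {R : Type u} [CommRing R]

/-- Bookkeeping: a factor of a product outside an ideal is outside the ideal. [folklore] -/
theorem notMem_of_dvd_of_notMem {I : Ideal R} {a b : R} (h : a ∣ b) (hb : b ∉ I) : a ∉ I := by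
  obtain ⟨c, rfl⟩ := h
  exact fun ha => hb (Ideal.mul_mem_right _ _ ha)

/-- **An inclusion of extended ideals at a prime spreads to a neighbourhood**: if `I` is
finitely generated and `I R_𝔭 ⊆ I' R_𝔭`, then `I R_𝔮 ⊆ I' R_𝔮` for all primes `𝔮` in a basic
open neighbourhood `D(f) ∋ 𝔭`. [folklore] -/
theorem Ideal.exists_notMem_forall_map_le (𝔭 : Ideal R) [𝔭.IsPrime] {I I' : Ideal R}
    (hI : I.FG)
    (h : I.map (algebraMap R (Localization.AtPrime 𝔭)) ≤
      I'.map (algebraMap R (Localization.AtPrime 𝔭))) :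
    ∃ f ∉ 𝔭, ∀ (𝔮 : Ideal R) [𝔮.IsPrime], f ∉ 𝔮 →
      I.map (algebraMap R (Localization.AtPrime 𝔮)) ≤
        I'.map (algebraMap R (Localization.AtPrime 𝔮)) := by
  classical
  obtain ⟨s, rfl⟩ := hI
  -- for each generator `g`, some `m_g ∉ 𝔭` with `m_g g ∈ I'`
  have hgen : ∀ g : s, ∃ m ∉ 𝔭, m * (g : R) ∈ I' := by
    intro g
    have hg : algebraMap R (Localization.AtPrime 𝔭) g ∈
        I'.map (algebraMap R (Localization.AtPrime 𝔭)) :=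
      h (Ideal.mem_map_of_mem _ (Ideal.subset_span g.2))
    obtain ⟨m, hm, hmg⟩ :=
      (IsLocalization.algebraMap_mem_map_algebraMap_iff 𝔭.primeCompl _ I' (g : R)).mp hg
    exact ⟨m, hm, hmg⟩
  choose m hm hmI using hgen
  refine ⟨∏ g : s, m g, ?_, fun 𝔮 _ hf => ?_⟩
  · exact prod_mem (S := 𝔭.primeCompl) fun g _ => hm g
  · rw [Ideal.map_span, Ideal.span_le]
    rintro _ ⟨g, hg, rfl⟩
    have hmq : m ⟨g, hg⟩ ∉ 𝔮 :=
      notMem_of_dvd_of_notMem (Finset.dvd_prod_of_mem (fun g : s => m g) (Finset.mem_univ _)) hf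
    rw [SetLike.mem_coe,
      IsLocalization.algebraMap_mem_map_algebraMap_iff 𝔮.primeCompl (Localization.AtPrime 𝔮)]
    exact ⟨m ⟨g, hg⟩, hmq, hmI ⟨g, hg⟩⟩

/-- **Equality of extended ideals at a prime spreads to a neighbourhood** (finitely generated
ideals). [folklore] -/
theorem Ideal.exists_notMem_forall_map_eq (𝔭 : Ideal R) [𝔭.IsPrime] {I I' : Ideal R}
    (hI : I.FG) (hI' : I'.FG)
    (h : I.map (algebraMap R (Localization.AtPrime 𝔭)) =
      I'.map (algebraMap R (Localization.AtPrime 𝔭))) :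
    ∃ f ∉ 𝔭, ∀ (𝔮 : Ideal R) [𝔮.IsPrime], f ∉ 𝔮 →
      I.map (algebraMap R (Localization.AtPrime 𝔮)) =
        I'.map (algebraMap R (Localization.AtPrime 𝔮)) := by
  obtain ⟨f₁, hf₁, h₁⟩ := Ideal.exists_notMem_forall_map_le 𝔭 hI h.le
  obtain ⟨f₂, hf₂, h₂⟩ := Ideal.exists_notMem_forall_map_le 𝔭 hI' h.ge
  refine ⟨f₁ * f₂, fun hp => (‹𝔭.IsPrime›.mem_or_mem hp).elim hf₁ hf₂, fun 𝔮 _ hf => ?_⟩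
  exact le_antisymm (h₁ 𝔮 (notMem_of_dvd_of_notMem (dvd_mul_right f₁ f₂) hf))
    (h₂ 𝔮 (notMem_of_dvd_of_notMem (dvd_mul_left f₂ f₁) hf))

/-- **Minimal primes away from `𝔭` can be avoided**: for an ideal `J` of a Noetherian ring
and a prime `𝔭` there is `h ∉ 𝔭` such that every minimal prime of `J` not containing `h` is
contained in `𝔭` (take the product of one element of `P ∖ 𝔭` for each of the finitely many
minimal primes `P ⊄ 𝔭`). [folklore] -/
theorem Ideal.exists_notMem_forall_minimalPrimes_le [IsNoetherianRing R] (J 𝔭 : Ideal R)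
    [𝔭.IsPrime] : ∃ h ∉ 𝔭, ∀ P ∈ J.minimalPrimes, h ∉ P → P ≤ 𝔭 := by
  classical
  have hfin := Ideal.finite_minimalPrimes_of_isNoetherianRing R J
  -- one element of `P ∖ 𝔭` for each minimal prime `P ⊄ 𝔭` (and `1` otherwise)
  have hpick : ∀ P : hfin.toFinset, ∃ g : R, g ∉ 𝔭 ∧ (¬ (P : Ideal R) ≤ 𝔭 → g ∈ (P : Ideal R)) := by
    intro P
    by_cases hP : (P : Ideal R) ≤ 𝔭
    · exact ⟨1, fun h1 => ‹𝔭.IsPrime›.ne_top ((Ideal.eq_top_iff_one _).mpr h1), fun h => (h hP).elim⟩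
    · obtain ⟨g, hgP, hg𝔭⟩ := Set.not_subset.mp hP
      exact ⟨g, hg𝔭, fun _ => hgP⟩
  choose g hg𝔭 hgP using hpick
  refine ⟨∏ P : hfin.toFinset, g P, prod_mem (S := 𝔭.primeCompl) fun P _ => hg𝔭 P,
    fun P hP hhP => ?_⟩
  by_contra hle
  have hPmem : P ∈ hfin.toFinset := hfin.mem_toFinset.mpr hP
  exact notMem_of_dvd_of_notMem
    (Finset.dvd_prod_of_mem (fun P : hfin.toFinset => g P) (Finset.mem_univ ⟨P, hPmem⟩)) hhP
    (hgP ⟨P, hPmem⟩ hle)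

/-- **The regular locus of a quotient, around a prime**: let `R` be of finite type over a
perfect field, `J ⊆ 𝔭` with `R_𝔭 / J R_𝔭` a regular local ring. Then `R_𝔮 / J R_𝔮` is regular
for all primes `𝔮 ⊇ J` in a basic open neighbourhood `D(g) ∋ 𝔭` (the regular locus of `R/J` is
open — Matsumura, Cor. to Thm. 30.5 over a perfect field, tree
`isOpen_regularLocus_of_perfectField` — and `R_𝔮/J R_𝔮 = (R/J)_{𝔮/J}`).
[cite: Matsumura1987, §30 Cor. to Thm. 30.5] -/
theorem exists_notMem_forall_isRegularLocalRing_quotient (k : Type u) [Field k] [PerfectField k]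
    [Algebra k R] [Algebra.FiniteType k R] (J 𝔭 : Ideal R) [𝔭.IsPrime] (hJ : J ≤ 𝔭)
    (hreg : IsRegularLocalRing
      (Localization.AtPrime 𝔭 ⧸ J.map (algebraMap R (Localization.AtPrime 𝔭)))) :
    ∃ g ∉ 𝔭, ∀ (𝔮 : Ideal R) [𝔮.IsPrime], g ∉ 𝔮 → J ≤ 𝔮 →
      IsRegularLocalRing (Localization.AtPrime 𝔮 ⧸ J.map (algebraMap R (Localization.AtPrime 𝔮))) := by
  classical
  let S := R ⧸ J
  haveI : Algebra.FiniteType k S := Algebra.FiniteType.trans (S := R) inferInstance inferInstance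
  have hopen : IsOpen (regularLocus S) := isOpen_regularLocus_of_perfectField k S
  haveI h𝔭' : (𝔭.map (Ideal.Quotient.mk J)).IsPrime := Ideal.isPrime_map_quotientMk_of_isPrime hJ
  let P : PrimeSpectrum S := ⟨𝔭.map (Ideal.Quotient.mk J), h𝔭'⟩
  have hP : P ∈ regularLocus S := (isRegularLocalRing_localization_quotient_iff J 𝔭 hJ).mp hreg
  obtain ⟨_, ⟨gbar, rfl⟩, hPg, hgU⟩ :=
    PrimeSpectrum.isTopologicalBasis_basic_opens.exists_subset_of_mem_open hP hopen
  obtain ⟨g, rfl⟩ := Ideal.Quotient.mk_surjective gbar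
  refine ⟨g, fun hg => hPg (Ideal.mem_map_of_mem _ hg), fun 𝔮 _ hg𝔮 hJ𝔮 => ?_⟩
  haveI h𝔮' : (𝔮.map (Ideal.Quotient.mk J)).IsPrime := Ideal.isPrime_map_quotientMk_of_isPrime hJ𝔮
  let Q : PrimeSpectrum S := ⟨𝔮.map (Ideal.Quotient.mk J), h𝔮'⟩
  have hQg : Q ∈ PrimeSpectrum.basicOpen (Ideal.Quotient.mk J g) := by
    change Ideal.Quotient.mk J g ∉ 𝔮.map (Ideal.Quotient.mk J)
    intro hmem
    apply hg𝔮
    have : g ∈ (𝔮.map (Ideal.Quotient.mk J)).comap (Ideal.Quotient.mk J) := hmem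
    rwa [Ideal.comap_map_of_surjective _ Ideal.Quotient.mk_surjective, ← RingHom.ker_eq_comap_bot,
      Ideal.mk_ker, sup_eq_left.mpr hJ𝔮] at this
  exact (isRegularLocalRing_localization_quotient_iff J 𝔮 hJ𝔮).mpr (hgU hQg)

end Spread

/-! ## Contractions of extended ideals -/

section Contract

variable {R : Type u} [CommRing R]

/-- If the extension `J R_𝔮` of an ideal `J ⊆ 𝔮` to the localisation at a prime `𝔮` is a
prime ideal, then its contraction to `R` is a minimal prime of `J`. [folklore] -/
theorem under_map_mem_minimalPrimes_of_isPrime (J 𝔮 : Ideal R) [𝔮.IsPrime]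
    [hprime : (J.map (algebraMap R (Localization.AtPrime 𝔮))).IsPrime] :
    (J.map (algebraMap R (Localization.AtPrime 𝔮))).under R ∈ J.minimalPrimes := by
  set B := Localization.AtPrime 𝔮
  set P := (J.map (algebraMap R B)).under R with hP
  haveI : P.IsPrime := Ideal.IsPrime.under R _
  refine ⟨⟨inferInstance, Ideal.le_comap_map⟩, ?_⟩
  rintro P₀ ⟨hP₀, hJP₀⟩ hP₀P
  -- `P₀ ⊆ P ⊆ 𝔮`-disjoint from the complement of `𝔮`, so `P₀ = (P₀ B) ∩ R ⊇ (J B) ∩ R = P`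
  have hP𝔮 : Disjoint (𝔮.primeCompl : Set R) (P : Set R) :=
    ((IsLocalization.isPrime_iff_isPrime_disjoint 𝔮.primeCompl B (J.map (algebraMap R B))).mp
      hprime).2
  have hP₀disj : Disjoint (𝔮.primeCompl : Set R) (P₀ : Set R) :=
    hP𝔮.mono_right (show (P₀ : Set R) ⊆ P from hP₀P)
  have h1 : (P₀.map (algebraMap R B)).under R = P₀ :=
    IsLocalization.under_map_of_isPrime_disjoint 𝔮.primeCompl B hP₀ hP₀disj
  rw [← h1]
  exact Ideal.comap_mono (Ideal.map_mono hJP₀)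

/-- A minimal prime `P` of `J` contained in the prime `𝔭` extends to `J R_𝔭` as soon as
`J R_𝔭` is prime: `P R_𝔭 = J R_𝔭`. [folklore] -/
theorem map_eq_map_of_mem_minimalPrimes (J 𝔭 P : Ideal R) [𝔭.IsPrime] (hP : P ∈ J.minimalPrimes)
    (hP𝔭 : P ≤ 𝔭) [hprime : (J.map (algebraMap R (Localization.AtPrime 𝔭))).IsPrime] :
    P.map (algebraMap R (Localization.AtPrime 𝔭)) =
      J.map (algebraMap R (Localization.AtPrime 𝔭)) := by
  set A := Localization.AtPrime 𝔭
  haveI : P.IsPrime := hP.1.1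
  -- the contraction `P₁` of the prime `J A` is a prime between `J` and `P`
  set P₁ := (J.map (algebraMap R A)).under R
  have hP₁ : P₁ ∈ J.minimalPrimes := under_map_mem_minimalPrimes_of_isPrime J 𝔭
  have hdisj : Disjoint (𝔭.primeCompl : Set R) (P : Set R) :=
    Set.disjoint_left.mpr fun a ha haP => ha (hP𝔭 haP)
  have hle : P₁ ≤ P := by
    have : P₁ ≤ (P.map (algebraMap R A)).under R := Ideal.comap_mono (Ideal.map_mono hP.1.2)
    rwa [IsLocalization.under_map_of_isPrime_disjoint 𝔭.primeCompl A hP.1.1 hdisj] at this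
  have heq : P₁ = P := le_antisymm hle (hP.2 hP₁.1 hle)
  rw [← heq]
  exact IsLocalization.map_under 𝔭.primeCompl A _

end Contract

/-! ## The main theorem -/

section Main

variable {R : Type u} [CommRing R]

/-- Bookkeeping: the image of a product of elements of the complement of a prime is a unit in
the localisation. [folklore] -/
theorem isUnit_prod_algebraMap_of_forall_notMem {ι : Type*} (t : Finset ι) (b : ι → R)
    (𝔮 : Ideal R) [𝔮.IsPrime] (hb : ∀ i ∈ t, b i ∉ 𝔮) :
    IsUnit (∏ i ∈ t, algebraMap R (Localization.AtPrime 𝔮) (b i)) := by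
  rw [← map_prod]
  exact IsLocalization.map_units (Localization.AtPrime 𝔮)
    ⟨∏ i ∈ t, b i, prod_mem (S := 𝔮.primeCompl) fun i hi => hb i hi⟩

/-- **The key step** (see the module docstring): with `A = R_𝔭`, `B = R_𝔮`, elements
`a₁, …, a_r ∈ R` whose images in `A` lie in `𝔪_A` with linearly independent differentials, a
subset `T'` of the indices with `J = (aᵢ : i ∈ T')`, suppose `B / J B` is regular and every
minimal prime of `J` inside `𝔮` lies inside `𝔭`. Then for `i ∉ T'` the image of `aᵢ` in `B` does
not lie in `J B`. [folklore] -/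
theorem algebraMap_notMem_map_span_image (𝔭 𝔮 : Ideal R) [𝔭.IsPrime] [𝔮.IsPrime]
    [IsRegularLocalRing (Localization.AtPrime 𝔭)] {r : ℕ} (a : Fin r → R)
    (hx' : ∀ i, algebraMap R (Localization.AtPrime 𝔭) (a i) ∈
      maximalIdeal (Localization.AtPrime 𝔭))
    (hli' : LinearIndependent (ResidueField (Localization.AtPrime 𝔭)) fun i =>
      (maximalIdeal (Localization.AtPrime 𝔭)).toCotangent ⟨algebraMap R _ (a i), hx' i⟩)
    (T' : Finset (Fin r)) {i : Fin r} (hi : i ∉ T')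
    (hreg : IsRegularLocalRing (Localization.AtPrime 𝔮 ⧸
      (Ideal.span (a '' (T' : Set (Fin r)))).map (algebraMap R (Localization.AtPrime 𝔮))))
    (hmin𝔭 : ∀ P ∈ (Ideal.span (a '' (T' : Set (Fin r)))).minimalPrimes, P ≤ 𝔮 → P ≤ 𝔭) :
    algebraMap R (Localization.AtPrime 𝔮) (a i) ∉
      (Ideal.span (a '' (T' : Set (Fin r)))).map (algebraMap R (Localization.AtPrime 𝔮)) := by
  intro hmem
  -- notation
  have hJA : (Ideal.span (a '' (T' : Set (Fin r)))).map (algebraMap R (Localization.AtPrime 𝔭)) =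
      Ideal.span ((fun i => algebraMap R (Localization.AtPrime 𝔭) (a i)) '' (T' : Set (Fin r))) := by
    rw [Ideal.map_span, Set.image_image]
  -- the prime `J B`, its contraction `P`, a minimal prime of `J` inside `𝔮`, hence inside `𝔭`
  haveI hprime : ((Ideal.span (a '' (T' : Set (Fin r)))).map
      (algebraMap R (Localization.AtPrime 𝔮))).IsPrime := by
    haveI := isDomain_of_isRegularLocalRing (Localization.AtPrime 𝔮 ⧸
      (Ideal.span (a '' (T' : Set (Fin r)))).map (algebraMap R (Localization.AtPrime 𝔮)))
    exact (Ideal.Quotient.isDomain_iff_prime _).mp ‹_›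
  have hPmin := under_map_mem_minimalPrimes_of_isPrime (Ideal.span (a '' (T' : Set (Fin r)))) 𝔮
  have hP𝔮 : ((Ideal.span (a '' (T' : Set (Fin r)))).map
      (algebraMap R (Localization.AtPrime 𝔮))).under R ≤ 𝔮 := by
    have : ((Ideal.span (a '' (T' : Set (Fin r)))).map
        (algebraMap R (Localization.AtPrime 𝔮))).under R ≤
        (maximalIdeal (Localization.AtPrime 𝔮)).under R :=
      Ideal.comap_mono (IsLocalRing.le_maximalIdeal hprime.ne_top)
    rwa [Localization.AtPrime.under_maximalIdeal] at this
  have hP𝔭 := hmin𝔭 _ hPmin hP𝔮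
  -- `P A = J A`, which is prime (generated by elements with independent differentials)
  haveI : ((Ideal.span (a '' (T' : Set (Fin r)))).map
      (algebraMap R (Localization.AtPrime 𝔭))).IsPrime := by
    rw [hJA]
    exact isPrime_span_image_of_linearIndependent_toCotangent _ hx' hli' _
  have hPA := map_eq_map_of_mem_minimalPrimes (Ideal.span (a '' (T' : Set (Fin r)))) 𝔭 _ hPmin hP𝔭
  -- `a i ∈ P`, so its image lies in `J A = (a_t : t ∈ T') A`: contradiction
  have haP : a i ∈ ((Ideal.span (a '' (T' : Set (Fin r)))).map
      (algebraMap R (Localization.AtPrime 𝔮))).under R := hmem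
  have : algebraMap R (Localization.AtPrime 𝔭) (a i) ∈
      Ideal.span ((fun i => algebraMap R (Localization.AtPrime 𝔭) (a i)) '' (T' : Set (Fin r))) := by
    rw [← hJA, ← hPA]
    exact Ideal.mem_map_of_mem _ haP
  exact not_mem_span_image_of_linearIndependent_toCotangent _ hx' hli' i _
    (fun h => hi (Finset.mem_coe.mp h)) this

/-- **The strict normal crossings condition spreads from a prime to a neighbourhood** (ring
form of the openness of the strict normal crossings locus; see the module docstring for the
proof): for `R` of finite type over a perfect field `k`, an ideal `I` and a prime `𝔭` such that
`I R_𝔭` has local strict normal crossings data, there is `f ∉ 𝔭` such that `I R_𝔮` has local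
strict normal crossings data for every prime `𝔮 ⊇ I` with `f ∉ 𝔮`. [folklore] -/
theorem IsSNCIdeal.exists_notMem_forall (k : Type u) [Field k] [PerfectField k] [Algebra k R]
    [Algebra.FiniteType k R] (I 𝔭 : Ideal R) [𝔭.IsPrime]
    (h : IsSNCIdeal (I.map (algebraMap R (Localization.AtPrime 𝔭)))) :
    ∃ f ∉ 𝔭, ∀ (𝔮 : Ideal R) [𝔮.IsPrime], f ∉ 𝔮 → I ≤ 𝔮 →
      IsSNCIdeal (I.map (algebraMap R (Localization.AtPrime 𝔮))) := by
  classical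
  haveI : IsNoetherianRing R := Algebra.FiniteType.isNoetherianRing k R
  set A := Localization.AtPrime 𝔭 with hA
  haveI hregA : IsRegularLocalRing A := h.isRegularLocalRing
  obtain ⟨r, x, hx, hr, hli, hIA⟩ := h.exists_linearIndependent
  /- (1) clear denominators: `x i = a i / s i`; the images `x' i` of the `a i` differ from the
  `x i` by units -/
  choose as has using fun i => IsLocalization.surj 𝔭.primeCompl (x i)
  let a : Fin r → R := fun i => (as i).1
  have hsunit : ∀ i, IsUnit (algebraMap R A ((as i).2 : R)) := fun i =>
    IsLocalization.map_units A (as i).2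
  let x' : Fin r → A := fun i => algebraMap R A (a i)
  have hax : ∀ i, x' i = x i * algebraMap R A ((as i).2 : R) := fun i => (has i).symm
  have hx' : ∀ i, x' i ∈ maximalIdeal A := fun i => by
    rw [hax i]
    exact Ideal.mul_mem_right _ _ (hx i)
  have ha𝔭 : ∀ i, a i ∈ 𝔭 := fun i =>
    (IsLocalization.AtPrime.to_map_mem_maximal_iff A 𝔭 (a i)).mp (hx' i)
  have hli' : LinearIndependent (ResidueField A)
      fun i => (maximalIdeal A).toCotangent ⟨x' i, hx' i⟩ := by
    have := hli.units_smul fun i => Units.map (IsLocalRing.residue A).toMonoidHom (hsunit i).unit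
    convert this using 1
    funext i
    rw [Pi.smul_apply', Units.smul_def, Units.coe_map]
    change _ = ((hsunit i).unit : A) • (maximalIdeal A).toCotangent ⟨x i, hx i⟩
    rw [← LinearMap.map_smul_of_tower]
    congr 1
    apply Subtype.ext
    change x' i = ((hsunit i).unit : A) * x i
    rw [IsUnit.unit_spec, mul_comm]
    exact hax i
  -- `I A = (∏ a i) A`
  have hIA' : I.map (algebraMap R A) = (Ideal.span {∏ i, a i}).map (algebraMap R A) := by
    rw [hIA, Ideal.map_span, Set.image_singleton, map_prod]
    have hprod : ∏ i, algebraMap R A (a i) = (∏ i, x i) * ∏ i, algebraMap R A ((as i).2 : R) := by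
      rw [← Finset.prod_mul_distrib]
      exact Finset.prod_congr rfl fun i _ => hax i
    rw [hprod, Ideal.span_singleton_mul_right_unit]
    exact isUnit_prod_algebraMap_of_forall_notMem _ _ 𝔭 fun i _ => (as i).2.2
  /- (2) spread the equality `I = (∏ a i)` to a neighbourhood -/
  obtain ⟨f₀, hf₀, hIq⟩ := Ideal.exists_notMem_forall_map_eq 𝔭 (IsNoetherian.noetherian I)
    (IsNoetherian.noetherian _) hIA'
  /- (3) the ideals `J T = (a i : i ∈ T)`; at `𝔭` their extensions are generated by elements
  with independent differentials -/
  let J : Finset (Fin r) → Ideal R := fun T => Ideal.span (a '' (T : Set (Fin r)))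
  have hJA : ∀ T, (J T).map (algebraMap R A) = Ideal.span (x' '' (T : Set (Fin r))) := by
    intro T
    rw [Ideal.map_span, Set.image_image]
  have hJle : ∀ (T : Finset (Fin r)) (𝔮 : Ideal R), (∀ i ∈ T, a i ∈ 𝔮) → J T ≤ 𝔮 := by
    intro T 𝔮 hT
    rw [Ideal.span_le]
    rintro _ ⟨i, hi, rfl⟩
    exact hT i hi
  have hJ𝔭 : ∀ T, J T ≤ 𝔭 := fun T => hJle T 𝔭 fun i _ => ha𝔭 i
  have hregJ : ∀ T, IsRegularLocalRing (A ⧸ (J T).map (algebraMap R A)) := by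
    intro T
    haveI := isRegularLocalRing_quotient_span_image_of_linearIndependent_toCotangent x' hx' hli'
      (T : Set (Fin r))
    exact IsRegularLocalRing.of_ringEquiv (Ideal.quotEquivOfEq (hJA T).symm)
  have hprimeJ : ∀ T, ((J T).map (algebraMap R A)).IsPrime := by
    intro T
    rw [hJA T]
    exact isPrime_span_image_of_linearIndependent_toCotangent x' hx' hli' _
  -- (a) regular loci of the `R / J T` around `𝔭`
  choose g hg hgreg using fun T : Finset (Fin r) =>
    exists_notMem_forall_isRegularLocalRing_quotient k (J T) 𝔭 (hJ𝔭 T) (hregJ T)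
  -- (b) minimal primes of the `J T` near `𝔭` lie inside `𝔭`
  choose hm hhm hhmin using fun T : Finset (Fin r) =>
    Ideal.exists_notMem_forall_minimalPrimes_le (J T) 𝔭
  /- (4) the element `f` -/
  refine ⟨f₀ * ∏ T, (g T * hm T), ?_, fun 𝔮 _ hf𝔮 hI𝔮 => ?_⟩
  · exact mul_mem (s := 𝔭.primeCompl) hf₀
      (prod_mem (S := 𝔭.primeCompl) fun T _ => mul_mem (hg T) (hhm T))
  /- (5) at a prime `𝔮 ∋ f̸` containing `I` -/
  set B := Localization.AtPrime 𝔮 with hB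
  have hf₀𝔮 : f₀ ∉ 𝔮 := notMem_of_dvd_of_notMem (dvd_mul_right _ _) hf𝔮
  have hprod𝔮 : ∏ T, (g T * hm T) ∉ 𝔮 := notMem_of_dvd_of_notMem (dvd_mul_left _ _) hf𝔮
  have hg𝔮 : ∀ T, g T ∉ 𝔮 := fun T =>
    notMem_of_dvd_of_notMem ((dvd_mul_right _ _).trans
      (Finset.dvd_prod_of_mem (fun T => g T * hm T) (Finset.mem_univ T))) hprod𝔮
  have hhm𝔮 : ∀ T, hm T ∉ 𝔮 := fun T =>
    notMem_of_dvd_of_notMem ((dvd_mul_left _ _).trans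
      (Finset.dvd_prod_of_mem (fun T => g T * hm T) (Finset.mem_univ T))) hprod𝔮
  -- the indices of the `a i` vanishing at `𝔮`
  set T₀ : Finset (Fin r) := Finset.univ.filter fun i => a i ∈ 𝔮 with hT₀
  have hmemT₀ : ∀ i, i ∈ T₀ ↔ a i ∈ 𝔮 := fun i => by simp [hT₀]
  -- `I B = (∏_{i ∈ T₀} a i) B`
  have hIB : I.map (algebraMap R B) = Ideal.span {∏ i ∈ T₀, algebraMap R B (a i)} := by
    rw [hIq 𝔮 hf₀𝔮, Ideal.map_span, Set.image_singleton, map_prod,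
      ← Finset.prod_filter_mul_prod_filter_not Finset.univ (fun i => a i ∈ 𝔮)]
    rw [Ideal.span_singleton_mul_right_unit]
    exact isUnit_prod_algebraMap_of_forall_notMem _ _ 𝔮 fun i hi => (Finset.mem_filter.mp hi).2
  -- `T₀` is non-empty as `I ⊆ 𝔮`
  have hT₀ne : T₀.Nonempty := by
    by_contra hne
    rw [Finset.not_nonempty_iff_eq_empty] at hne
    rw [hne, Finset.prod_empty, Ideal.span_singleton_one] at hIB
    have hle : I.map (algebraMap R B) ≤ maximalIdeal B := by
      rw [← Localization.AtPrime.map_eq_maximalIdeal]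
      exact Ideal.map_mono hI𝔮
    rw [hIB] at hle
    exact (maximalIdeal.isMaximal B).ne_top (top_le_iff.mp hle)
  -- enumerate `T₀`
  set t := T₀.card with ht
  let ε : Fin t ≃ T₀ := T₀.equivFin.symm
  let z : Fin t → B := fun j => algebraMap R B (a (ε j))
  have hzT₀ : ∀ j, ((ε j : Fin r)) ∈ T₀ := fun j => (ε j).2
  have hz : ∀ j, z j ∈ maximalIdeal B := fun j =>
    (IsLocalization.AtPrime.to_map_mem_maximal_iff B 𝔮 _).mpr ((hmemT₀ _).mp (hzT₀ j))
  have ht1 : 1 ≤ t := Finset.card_pos.mpr hT₀ne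
  -- images of sub-families of `T₀` as extensions of the `J T`
  let ι' : Finset (Fin t) → Finset (Fin r) := fun S => S.image fun j => (ε j : Fin r)
  have himage : ∀ S : Finset (Fin t),
      z '' (S : Set (Fin t)) = algebraMap R B '' (a '' (ι' S : Set (Fin r))) := by
    intro S
    simp only [ι', Finset.coe_image, Set.image_image]
    rfl
  have hspanS : ∀ S : Finset (Fin t),
      Ideal.span (z '' (S : Set (Fin t))) = (J (ι' S)).map (algebraMap R B) := by
    intro S
    rw [himage S, Ideal.map_span]
  have hι'T₀ : ∀ (S : Finset (Fin t)), ∀ i ∈ ι' S, i ∈ T₀ := by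
    intro S i hi
    obtain ⟨j, -, rfl⟩ := Finset.mem_image.mp hi
    exact hzT₀ j
  have hJ𝔮 : ∀ S : Finset (Fin t), J (ι' S) ≤ 𝔮 :=
    fun S => hJle _ 𝔮 fun i hi => (hmemT₀ i).mp (hι'T₀ S i hi)
  -- (a) at `𝔮`: the quotients `B / (z_S)` are regular
  have hregS : ∀ S : Finset (Fin t),
      IsRegularLocalRing (B ⧸ (J (ι' S)).map (algebraMap R B)) :=
    fun S => hgreg _ 𝔮 (hg𝔮 _) (hJ𝔮 S)
  haveI : IsRegularLocalRing (B ⧸ Ideal.span (Set.range z)) := by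
    rw [← Set.image_univ, ← Finset.coe_univ, hspanS]
    exact hregS _
  -- `B` itself is regular (`S = ∅`)
  haveI hregB : IsRegularLocalRing B := by
    have h0 := hregS ∅
    rw [← hspanS, Finset.coe_empty, Set.image_empty, Ideal.span_empty] at h0
    exact IsRegularLocalRing.of_ringEquiv (RingEquiv.quotientBot B)
  -- minimality: no `z j` lies in the ideal of the others
  have hmin : ∀ j, z j ∉ Ideal.span (z '' {j' | j' ≠ j}) := by
    intro j
    have hset : ({j' | j' ≠ j} : Set (Fin t)) = ((Finset.univ.erase j : Finset (Fin t)) : Set (Fin t)) := by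
      ext j'
      simp
    rw [hset, hspanS]
    refine algebraMap_notMem_map_span_image 𝔭 𝔮 a hx' hli' _ ?_ (hregS _) ?_
    · intro hi
      obtain ⟨j', hj', hjj'⟩ := Finset.mem_image.mp hi
      exact (Finset.mem_erase.mp hj').1 (ε.injective (Subtype.ext hjj'))
    · intro P hP hP𝔮
      exact hhmin _ P hP fun hh => hhm𝔮 _ (hP𝔮 hh)
  -- conclude
  have hprodz : ∏ j, z j = ∏ i ∈ T₀, algebraMap R B (a i) := by
    rw [← Finset.prod_coe_sort T₀]
    exact Fintype.prod_equiv ε _ (fun i : T₀ => algebraMap R B (a i)) fun j => rfl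
  refine IsSNCIdeal.of_isRegularLocalRing_quotient ht1 z hz hmin ?_
  rw [hIB, hprodz]

end Main

end Literature.AlgebraicGeometry.Resolution

end
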